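import Summits.ResolutionOfSingularities.ResolutionOfSingularities.Theorems.PurelyInseparableDim4ResConeLetterSetEntry
import Summits.ResolutionOfSingularities.ResolutionOfSingularities.Theorems.PurelyInseparableDim4ResConePermanentConeLetter
import HarnessLib
import HarnessLib.Audit.Tags

/-!
# Purely inseparable four-folds — the ENTRY FRAME WITH A FROZEN CONE MONOMIAL: E_set instantiated on the frozen set `P`
# (rung-2 mechanism «Φ-line with a frozen cone monomial», holder rulings g5-4 (5) / g5-8; K2(p) lane; cell `res-dim4-pi`)

[OURS · counted 0 · cell `res-dim4-pi` · K2(p) lane holder res-dim4-p-12 g5; seat res-dim4-p-9 g5 (E_set), composing its own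
`…LetterSetEntry` (`tail_entryFrame_letters`) and `…PermanentConeLetter` (`permanentSet_coneLetters`).]  Nothing here proves any
TAIL(p, d, e), K2(p), K2(7) or resolution of singularities in dimension ≥ 4 / characteristic `p` — NOT proved.  AI kernel work, weaker
than expert review.

On a witnessed isolated above-floor `Step0 p` chain with `x^{r₀} ∣ F₀`, constant shade `d < p` and `e_G = 2` from `k₀`, let `P` be a set of
letters PERMANENT from `k₁ ≥ k₀` (never the chart, never translated).  By `permanentSet_coneLetters` every `z ∈ P` is a cone letter at every
`k ≥ k₁`, hence cone-aligned with every letter; so for a letter `h ∉ P` with a transversal kernel vector at `k ≥ k₁` and the THRESHOLD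
`p ≤ r_k h + Σ_{z∈P} r_k z + n`, `n ≤ d`, the letter-set entry frame fires with `T = insert h P`:
* **`tail_entryFrame_frozenCone`** — transversal vector arbitrary;
* **`tail_entryFrame_frozenCone_of_hit`** — the transversal vector is the step direction of a step that HITS `h` (`j k = h ∨ b k h ≠ 0`),
  the shape the holder's assembly `…FrozenConeTail` consumes at an entry/LOSE edge.
[cite: CossartJannsenSaito2020, Def. 8.4, Lemma 11.5, Lemma 12.2 (2), Thm. 3.14] [cite: CossartPiltant2008, §4 p. 11]
bears_on: LADDER-RESOLUTION:D157-DOOR2 (res-dim4-pi · K2(p) · rung-2 E_set on the frozen set).  Supports stmt-ResolutionOfSingularities-16155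
(helper).
-/

set_option linter.dupNamespace false -- mandated namespace of this single-conjunct summit

noncomputable section

namespace Summit.ResolutionOfSingularities.ResolutionOfSingularities.Theorems.PIDim4

namespace ResCone

open MvPolynomial Finset IsLocalRing
open Literature.AlgebraicGeometry.Resolution
open Literature.AlgebraicGeometry.Resolution.CentreBlowup
open Literature.AlgebraicGeometry.Resolution.Hauser2010
open Literature.AlgebraicGeometry.Resolution.HauserPerlega2019
open Literature.AlgebraicGeometry.Resolution.WeightedOrder
open PointBlowup (additiveSubspace direction)

variable {K : Type} [Field K] {p : ℕ} [Fact p.Prime] [CharP K p] [DecidableEq K]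

/-- **THE ENTRY FRAME WITH A FROZEN CONE MONOMIAL** (E_set on the frozen set).  Along a witnessed isolated above-floor `Step0 p` chain with
`x^{r₀} ∣ F₀`, constant shade `d < p` and `e_G = 2` from `k₀`, let `P` be permanent from `k₁ ≥ k₀`, `h ∉ P` a letter with a transversal
kernel vector `w` at `k ≥ k₁`, and `p ≤ r_k h + Σ_{z∈P} r_k z + n`, `n ≤ d`.  Then the entry 6-tuple at `k` with `u₁ = e_h` exists (`M·L = 1`,
`L u₁ = e_h`, y-rows ⟂ `resVertex (c k)`, `pts ≠ ∅`, `d! < δs`, `d·αs ≤ (n−1)·d!` for `(G_k)`).  The letters of `P` are cone letters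
(`permanentSet_coneLetters`), so they are cone-aligned with `h` for free. [OURS]
[cite: CossartJannsenSaito2020, Def. 8.4, Lemma 11.5, Lemma 12.2 (2), Thm. 3.14] -/
theorem tail_entryFrame_frozenCone {d n : ℕ} (hdp : d < p) (hnd : n ≤ d) {c : ℕ → State K} {j : ℕ → Fin 4}
    {b : ℕ → Fin 4 → K} (hc : ∀ k, IsIsolated p (c k).F ∧ Step0 p (c k) (c (k + 1)))
    (hw : FreeTail.IsWitnessedChain p c j b) (hr0 : ∀ e ∈ (c 0).F.support, (c 0).r ≤ e)
    (hfloor : ∀ k, ordZero (c k).F ≠ p) {k₀ : ℕ} (hshade : ∀ k, k₀ ≤ k → (c k).shade = ((d : ℕ) : ℕ∞))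
    (he : ∀ k, k₀ ≤ k → Module.finrank K (resVertex (c k)) = 2) {k₁ : ℕ} (hk₁ : k₀ ≤ k₁) {P : Finset (Fin 4)}
    (hperm : ∀ z ∈ P, ∀ k, k₁ ≤ k → j k ≠ z ∧ b k z = 0) {k : ℕ} (hk : k₁ ≤ k) {h : Fin 4} (hhP : h ∉ P)
    {w : Fin 4 → K} (hwV : w ∈ resVertex (c k)) (hwh : w h ≠ 0)
    (hthr : p ≤ (c k).r h + ∑ z ∈ P, (c k).r z + n) :
    ∃ (L : Fin (2 + 2) → Fin 4 → K) (M : Fin 4 → Fin (2 + 2) → K),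
      (∀ t u, ∑ i, M t i * L i u = if t = u then 1 else 0) ∧ L (u1 2) = Pi.single h 1 ∧
      (∀ i, i ≠ u1 2 → i ≠ u2 2 → ∀ v ∈ resVertex (c k), ∑ t, L i t * v t = 0) ∧
      (pts (fun i => algebraMap (MvPolynomial (Fin 4) K) (OriginLocalization K 4) (∑ t, C (L i t) * X t))
        (Ideal.span {algebraMap (MvPolynomial (Fin 4) K) (OriginLocalization K 4)
          ((c k).F.divMonomial (c k).r)}) d).Nonempty ∧
      Nat.factorial d < deltaS (fun i => algebraMap (MvPolynomial (Fin 4) K) (OriginLocalization K 4)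
        (∑ t, C (L i t) * X t)) (Ideal.span {algebraMap (MvPolynomial (Fin 4) K) (OriginLocalization K 4)
          ((c k).F.divMonomial (c k).r)}) d ∧
      d * alphaS (fun i => algebraMap (MvPolynomial (Fin 4) K) (OriginLocalization K 4) (∑ t, C (L i t) * X t))
        (Ideal.span {algebraMap (MvPolynomial (Fin 4) K) (OriginLocalization K 4)
          ((c k).F.divMonomial (c k).r)}) d ≤ (n - 1) * Nat.factorial d := by
  have hcone := permanentSet_coneLetters hc hw hr0 hfloor hshade he hk₁ hperm
  have hT : ∀ i ∈ insert h P, i ≠ h → ∀ v ∈ resVertex (c k), v h = 0 → v i = 0 := by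
    intro i hi hih v hv _
    rcases Finset.mem_insert.mp hi with hi' | hi'
    · exact absurd hi' hih
    · exact hcone i hi' k hk v hv
  have hn : p ≤ ∑ i ∈ insert h P, (c k).r i + n := by rw [Finset.sum_insert hhP]; omega
  exact tail_entryFrame_letters hdp hnd hc hr0 hfloor hshade he (show k₀ ≤ k by omega) hwV hwh (insert h P) hT hn

/-- **THE ENTRY FRAME WITH A FROZEN CONE MONOMIAL AT A HIT** — as `tail_entryFrame_frozenCone`, the transversal vector being the step
direction of a step at `k` that HITS `h` (`j k = h ∨ b k h ≠ 0`): `direction (j k) (b k) ∈ resVertex (c k)` (`chain_direction_mem_resVertex`)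
has `h`-coordinate `1` resp. `b k h ≠ 0`. [OURS] [cite: CossartJannsenSaito2020, Def. 8.4, Lemma 12.2 (2), Thm. 3.14] -/
theorem tail_entryFrame_frozenCone_of_hit {d n : ℕ} (hdp : d < p) (hnd : n ≤ d) {c : ℕ → State K} {j : ℕ → Fin 4}
    {b : ℕ → Fin 4 → K} (hc : ∀ k, IsIsolated p (c k).F ∧ Step0 p (c k) (c (k + 1)))
    (hw : FreeTail.IsWitnessedChain p c j b) (hr0 : ∀ e ∈ (c 0).F.support, (c 0).r ≤ e)
    (hfloor : ∀ k, ordZero (c k).F ≠ p) {k₀ : ℕ} (hshade : ∀ k, k₀ ≤ k → (c k).shade = ((d : ℕ) : ℕ∞))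
    (he : ∀ k, k₀ ≤ k → Module.finrank K (resVertex (c k)) = 2) {k₁ : ℕ} (hk₁ : k₀ ≤ k₁) {P : Finset (Fin 4)}
    (hperm : ∀ z ∈ P, ∀ k, k₁ ≤ k → j k ≠ z ∧ b k z = 0) {k : ℕ} (hk : k₁ ≤ k) {h : Fin 4} (hhP : h ∉ P)
    (hhit : j k = h ∨ b k h ≠ 0) (hthr : p ≤ (c k).r h + ∑ z ∈ P, (c k).r z + n) :
    ∃ (L : Fin (2 + 2) → Fin 4 → K) (M : Fin 4 → Fin (2 + 2) → K),
      (∀ t u, ∑ i, M t i * L i u = if t = u then 1 else 0) ∧ L (u1 2) = Pi.single h 1 ∧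
      (∀ i, i ≠ u1 2 → i ≠ u2 2 → ∀ v ∈ resVertex (c k), ∑ t, L i t * v t = 0) ∧
      (pts (fun i => algebraMap (MvPolynomial (Fin 4) K) (OriginLocalization K 4) (∑ t, C (L i t) * X t))
        (Ideal.span {algebraMap (MvPolynomial (Fin 4) K) (OriginLocalization K 4)
          ((c k).F.divMonomial (c k).r)}) d).Nonempty ∧
      Nat.factorial d < deltaS (fun i => algebraMap (MvPolynomial (Fin 4) K) (OriginLocalization K 4)
        (∑ t, C (L i t) * X t)) (Ideal.span {algebraMap (MvPolynomial (Fin 4) K) (OriginLocalization K 4)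
          ((c k).F.divMonomial (c k).r)}) d ∧
      d * alphaS (fun i => algebraMap (MvPolynomial (Fin 4) K) (OriginLocalization K 4) (∑ t, C (L i t) * X t))
        (Ideal.span {algebraMap (MvPolynomial (Fin 4) K) (OriginLocalization K 4)
          ((c k).F.divMonomial (c k).r)}) d ≤ (n - 1) * Nat.factorial d := by
  have hdir : direction (j k) (b k) ∈ resVertex (c k) :=
    chain_direction_mem_resVertex p hc hw hr0 hfloor hshade (show k₀ ≤ k by omega)
  have hdirh : direction (j k) (b k) h ≠ 0 := by
    by_cases hjh : j k = h
    · rw [← hjh, direction_apply_self]; exact one_ne_zero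
    · rw [direction_apply_of_ne (Ne.symm hjh)]; exact hhit.resolve_left hjh
  exact tail_entryFrame_frozenCone hdp hnd hc hw hr0 hfloor hshade he hk₁ hperm hk hhP hdir hdirh hthr

end ResCone

end Summit.ResolutionOfSingularities.ResolutionOfSingularities.Theorems.PIDim4

end
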